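import Summits.NavierStokesRegularity.TurbBounds.Certs.N1prime.EvalData6
import Summits.NavierStokesRegularity.TurbBounds.TailN1primeMode5
import Summits.NavierStokesRegularity.TurbBounds.TailN1primeLadderForms
import Summits.NavierStokesRegularity.TurbBounds.TailN1primeExt
import Summits.NavierStokesRegularity.TurbBounds.QuadFormEval
import HarnessLib

/-!
# Row RB-N1′ tail lemma (dim 62) — structured quadratic form of the literal rule piece `CE5`, part 11/14 (v2.1: list-level evaluation)
(cell `pub-turb` / `turb-bounds`; v2; GENERATED by pub-turb-cert gen 7 `emit_pieces_v21.py N1prime` from the staged `Certs/N1prime/EvalData*.lean`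
literals; the identity says 'this literal (projected) piece IS the Legendre–Galerkin object of rbsdp SPEC 3.3–3.6 on the kept coordinates'
(LEAN-MAP data item (a) for row RB-N1′). Proof: `QuadFormEval.dotProduct_mulVec_eq_rowsEval` turns the quadratic form into a structural
recursion over the row lists (unfolded by `simp only`, linear in the 2210 listed entries), then `ring` over the ladder forms.)

HONEST FRAMING: rigorous bounds for the stated PDE and boundary conditions; no claim about physical turbulence beyond the bound.
-/

set_option linter.style.longLine false
set_option linter.style.setOption false
set_option maxRecDepth 100000

noncomputable section

namespace Summit.NavierStokesRegularity.TurbBounds.TailN1prime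

open Finset Matrix Literature.Computation.Certificates
open Summit.NavierStokesRegularity.TurbBounds.LadderTail (w phi lam)
open Summit.NavierStokesRegularity.TurbBounds.CouplingSplit (couplingMode)
open Summit.NavierStokesRegularity.TurbBounds.Certs.N1prime.Evaluator

set_option maxHeartbeats 20000000 in
/-- structured quadratic form of the literal piece `CE5` (62×62 kept coordinates, 2210 listed / 432 nonzero entries) — twice the exact coupling form of profile mode 5 at the ladder coefficients -/
theorem quadForm_CE5 (x : Fin 62 → ℝ) :
    x ⬝ᵥ (CE5.map (Rat.cast : ℚ → ℝ) *ᵥ x) = 2 * couplingMode 24 6 5 (bL x) (eL x) := by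
  rw [couplingMode_5_eq]
  rw [show CE5 = matrixOfRows 62 62 CE5_rows from rfl,
    QuadFormEval.dotProduct_mulVec_eq_rowsEval CE5_rows x (ext x) (ext_val x) (ext_zero x)]
  simp only [CE5_rows, CE5_rows_r0, CE5_rows_r1, CE5_rows_r2, CE5_rows_r3, CE5_rows_r4, CE5_rows_r5, CE5_rows_r6, CE5_rows_r7, CE5_rows_r8, CE5_rows_r9, CE5_rows_r10, CE5_rows_r11, CE5_rows_r12, CE5_rows_r13, CE5_rows_r14, CE5_rows_r15, CE5_rows_r16, CE5_rows_r17, CE5_rows_r18, CE5_rows_r19, CE5_rows_r20, CE5_rows_r21, CE5_rows_r22, CE5_rows_r23, CE5_rows_r24, CE5_rows_r25, CE5_rows_r26, CE5_rows_r27, CE5_rows_r28, CE5_rows_r29, CE5_rows_r30, CE5_rows_r31, CE5_rows_r32, CE5_rows_r33, CE5_rows_r34, CE5_rows_r35, CE5_rows_r36, CE5_rows_r37, CE5_rows_r38, CE5_rows_r39, CE5_rows_r40, CE5_rows_r41, CE5_rows_r42, CE5_rows_r43, CE5_rows_r44, CE5_rows_r45, CE5_rows_r46, CE5_rows_r47,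 CE5_rows_r48, CE5_rows_r49, CE5_rows_r50, CE5_rows_r51, CE5_rows_r52, CE5_rows_r53, CE5_rows_r54, CE5_rows_r55, CE5_rows_r56, CE5_rows_r57, CE5_rows_r58, CE5_rows_r59, CE5_rows_r60, CE5_rows_r61,
    QuadFormEval.rowsEval_cons, QuadFormEval.rowsEval_nil, QuadFormEval.rowEval_cons, QuadFormEval.rowEval_nil, ext, Rat.cast_zero, zero_mul, mul_zero, zero_add, add_zero,
    bL, aL, eL, xc, xd]
  push_cast
  ring

end Summit.NavierStokesRegularity.TurbBounds.TailN1prime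

end
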